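import Literature.NumberTheory.GaloisRepresentations.IdeleInflation
import Literature.NumberTheory.GaloisRepresentations.IdeleSUnitsRep
import Literature.Algebra.Homology.InhomogeneousCochainsToolkit
import HarnessLib

/-!
# The finite-layer chase of NSW (8.3.11) for the `S`-units: `p`-divisibility of `H²(Gal(E/F), 𝒪ˣ_{E,S})`
# and death of `p`-torsion in `H³(Gal(E/F), 𝒪ˣ_{E,S})` up the layers of `K_S`, AT COCHAIN LEVEL inside `J_E`

Topic `NumberTheory/GaloisRepresentations`; namespace `Literature.NumberTheory.GaloisRepresentations.IdeleCohomology`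
(the namespace of the tree's finite-layer idèle cohomology: `ideleSRep F E S` = Tate's `J_{E,S}`, `IdeleClassGroup.ideleRep F E`
= `J_E`, `IdeleClassGroup.galoisRep F E` = `C_E`, `principalRepHom`/`classRepHom`/`ideleClassShortComplex_shortExact` =
`0 → Eˣ → J_E → C_E → 0`, `unitsInflHom`/`ideleInflHom`/`classInflHom` = the layer-change pair morphisms over
`AlgEquiv.restrictNormalHom E`).  THEOREMS ONLY: no definition, no named fact, no instance, no `sorry`.

## Mathematics (Neukirch–Schmidt–Wingberg (8.3.11) (iii)/(iv) ⇒ (8.3.17)/(8.3.18), finite layers)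

Let `F` be a number field, `S` a finite set of finite places of `F`, and `F ⊆ E ⊆ E₁ ⊆ E₂` finite Galois layers (inside the
maximal extension `K_S` unramified outside `S`, although nothing below uses unramifiedness).  Write `G = Gal(E/F)`,
`J_{E,S} ⊆ J_E` for the `S`-idèles, `C_E = J_E/Eˣ`, and `𝒪ˣ_{E,S} = Eˣ ∩ J_{E,S}` for the `S`-units, realised — as in the lane's
object of record `sUnitsIdeleRep` — as the PRINCIPAL `S`-IDÈLES inside `J_{E,S}`.  NSW prove `cd_p G_S ≤ 2` ((8.3.17)–(8.3.18)) from
(8.3.11): in the limit over the layers, `H²(G_S, 𝒪ˣ_S)` is `p`-divisible and `H³(G_S, 𝒪ˣ_S)[p] = 0`, the two inputs being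
(a) the local degrees of `K_S/F` at `v ∈ S ⊇ S_p` are divisible by `p^∞`, and (b) every idèle class of a layer capitulates into
`E′ˣ·J_{E′,S}` in a higher layer `E′ ⊆ K_S` (principal ideal theorem; `lim→ Cl_S = 0`).  This file and its sequel prove the two FINITE-LAYER
transfer statements behind this, by an explicit chase with inhomogeneous cochains inside `J_E` (so that no quotient module
`J_{E,S}/𝒪ˣ_{E,S}`, `Cl_S(E)` and no connecting-homomorphism naturality is needed):

* `exists_smul_eq_inf_inf_sUnits_two` — **(iii-fin)**: if `x ∈ H²(G, 𝒪ˣ_{E,S})` and at the layer `E₁` there is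
  `ζ ∈ H²(Gal(E₁/F), J_{E₁,S})` with `m • ζ = Inf (ι_* x)` whose image in `H²(Gal(E₁/F), C_{E₁})` vanishes (supplied from (a)
  by the local-invariant arithmetic of the sequel), and every idèle of `E₁` capitulates in `E₂` (b), then `m • z = Inf Inf x` for
  some `z ∈ H²(Gal(E₂/F), 𝒪ˣ_{E₂,S})`;
* the sequel `IdeleSUnitsLayerChaseThree` proves **(iv-fin)** (`inf_inf_sUnits_three_eq_zero`: `p`-torsion of
  `H³(G, 𝒪ˣ_{E,S})` dies two layers up) by the same method; §1 here collects the pointwise facts about `Eˣ → J_E → C_E`,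
  `J_{E,S}` and the layer change used by both files.

The `S`-unit objects and the layer-change morphisms are BINDERS with their defining properties as hypotheses (`hO` : an
`S`-idèle comes from `O` iff it is principal — token for token `ideleSToClass_hom_apply_eq_zero_iff` of the lane's
`IdeleSUnitsClassSequence`; the two commuting squares with `ideleInflHom`), so that the file depends on the tree only.

## References
* J. Neukirch, A. Schmidt, K. Wingberg, *Cohomology of Number Fields*, 2nd ed. (2008), VIII §3: (8.3.11), (8.3.17), (8.3.18).
  [NeukirchSchmidtWingberg2008]
* D. Harari, *Galois Cohomology and Class Field Theory* (2020), §17.4, Lemma 17.21, Cor. 17.14. [Harari2020]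
* K. S. Brown, *Cohomology of Groups*, GTM 87 (1982), III §1, §8 (inhomogeneous cochains, functoriality). [Brown1982CohomologyGroups]
-/

noncomputable section

open CategoryTheory NumberField IsDedekindDomain groupCohomology
open Literature.Algebra.Homology Literature.Algebra.Homology.InhomogeneousCochains Literature.NumberTheory.Automorphic

namespace Literature.NumberTheory.GaloisRepresentations

namespace IdeleCohomology

/-! ## §1. Pointwise facts about `Eˣ → J_E → C_E`, `J_{E,S}` and the principal `S`-idèles -/

section Pointwise

variable {F E : Type} [Field F] [NumberField F] [Field E] [NumberField E] [Algebra F E]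
  {S : Finset (HeightOneSpectrum (𝓞 F))}

omit [NumberField F] in
/-- An idèle has trivial class iff it is principal. [cite: CasselsFrohlichANT1967, Ch. VII §8] -/
theorem classRepHom_hom_eq_zero_iff (x : Additive (ideleGroup E)) :
    (IdeleClassGroup.classRepHom F E).hom x = 0 ↔ (Additive.toMul x : ideleGroup E) ∈ principalIdeles E := by
  rw [IdeleClassGroup.classRepHom_apply]
  exact QuotientGroup.eq_one_iff (Additive.toMul x)

omit [NumberField F] in
/-- An idèle with trivial class is the principal idèle of a unit of `E`. [cite: CasselsFrohlichANT1967, Ch. VII §8] -/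
theorem exists_principalRepHom_eq_of_classRepHom_eq_zero (x : IdeleClassGroup.ideleRep F E)
    (hx : (IdeleClassGroup.classRepHom F E).hom x = 0) :
    ∃ e : Rep.ofAlgebraAutOnUnits F E, (IdeleClassGroup.principalRepHom F E).hom e = x := by
  obtain ⟨k, hk⟩ := (classRepHom_hom_eq_zero_iff x).1 hx
  exact ⟨Additive.ofMul k, congrArg Additive.ofMul hk⟩

omit [NumberField F] in
/-- The class of a principal idèle is trivial. [cite: CasselsFrohlichANT1967, Ch. VII §8] -/
theorem classRepHom_principalRepHom (e : Rep.ofAlgebraAutOnUnits F E) :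
    (IdeleClassGroup.classRepHom F E).hom ((IdeleClassGroup.principalRepHom F E).hom e) = 0 :=
  (classRepHom_hom_eq_zero_iff _).2 ⟨Additive.toMul e, rfl⟩

omit [NumberField F] in
/-- Every idèle class is the class of an idèle. [cite: CasselsFrohlichANT1967, Ch. VII §8] -/
theorem exists_classRepHom_eq (c : IdeleClassGroup.galoisRep F E) :
    ∃ x : IdeleClassGroup.ideleRep F E, (IdeleClassGroup.classRepHom F E).hom x = c := by
  obtain ⟨y, hy⟩ := QuotientGroup.mk_surjective (Additive.toMul (α := IdeleClassGroup E) c)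
  exact ⟨Additive.ofMul y, (congrArg Additive.ofMul hy).trans rfl⟩

/-- Unpacking a capitulation `a ∈ E'ˣ · J_{E',S}` additively: `a = (k) + w` in `J_{E'}` with `k ∈ E'ˣ`, `w ∈ J_{E',S}`.
[cite: NeukirchSchmidtWingberg2008, (8.3.11)] -/
theorem exists_principal_add_ideleS_eq_of_mem_sup (a : ideleGroup E)
    (h : a ∈ principalIdeles E ⊔ ideleS F E S) :
    ∃ (k : Rep.ofAlgebraAutOnUnits F E) (w : ideleSRep F E S),
      (IdeleClassGroup.principalRepHom F E).hom k + (ideleSRepHom S).hom w = Additive.ofMul a := by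
  obtain ⟨y, ⟨k, rfl⟩, w, hw, hyw⟩ := Subgroup.mem_sup.mp h
  exact ⟨Additive.ofMul k, Additive.ofMul (⟨w, hw⟩ : ideleS F E S), congrArg Additive.ofMul hyw⟩

/-- An `S`-idèle whose image in `J_E` is a principal idèle is principal (bookkeeping between the two currencies).
[cite: CasselsFrohlichANT1967, Ch. VII §7.3] -/
theorem toMul_mem_principalIdeles_of_ideleSRepHom_eq (y : ideleSRep F E S) (e : Rep.ofAlgebraAutOnUnits F E)
    (h : (ideleSRepHom S).hom y = (IdeleClassGroup.principalRepHom F E).hom e) :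
    ((Additive.toMul y : ideleS F E S) : ideleGroup E) ∈ principalIdeles E :=
  ⟨Additive.toMul e, (congrArg Additive.toMul h).symm⟩

variable {E' : Type} [Field E'] [NumberField E'] [Algebra E E'] [Algebra F E'] [IsScalarTower F E E'] [Normal F E]

omit [NumberField F] in
/-- Pointwise square `Eˣ → J_E` / `E'ˣ → J_{E'}` under the layer change (tree `res_principalRepHom_comp_ideleInflHom`).
[cite: CasselsFrohlichANT1967, Ch. VII §11.1] -/
theorem ideleInflHom_principalRepHom (e : Rep.ofAlgebraAutOnUnits F E) :
    (ideleInflHom F E E').hom ((IdeleClassGroup.principalRepHom F E).hom e) =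
      (IdeleClassGroup.principalRepHom F E').hom ((unitsInflHom F E E').hom e) :=
  congrArg (fun φ => φ.hom e) (res_principalRepHom_comp_ideleInflHom (F := F) (E := E) (E' := E'))

/-- Pointwise square `J_E → C_E` / `J_{E'} → C_{E'}` under the layer change (tree `res_classRepHom_comp_classInflHom`).
[cite: CasselsFrohlichANT1967, Ch. VII §11.1] -/
theorem classInflHom_classRepHom (y : IdeleClassGroup.ideleRep F E) :
    (classInflHom F E E').hom ((IdeleClassGroup.classRepHom F E).hom y) =
      (IdeleClassGroup.classRepHom F E').hom ((ideleInflHom F E E').hom y) :=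
  congrArg (fun φ => φ.hom y) (res_classRepHom_comp_classInflHom (F := F) (E := E) (E' := E'))

end Pointwise

/-! ## §2. The `H²` transfer (NSW (8.3.11) (iii) at finite layers) -/

section HTwo

variable {F E E₁ E₂ : Type} [Field F] [NumberField F] [Field E] [NumberField E] [Field E₁] [NumberField E₁]
  [Field E₂] [NumberField E₂]
  [Algebra F E] [Algebra F E₁] [Algebra F E₂] [Algebra E E₁] [Algebra E₁ E₂]
  [IsScalarTower F E E₁] [IsScalarTower F E₁ E₂] [IsGalois F E] [IsGalois F E₁]
  {S : Finset (HeightOneSpectrum (𝓞 F))}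

/-- **NSW (8.3.11) (iii), finite layers — `p`-divisibility of `H²(·, 𝒪ˣ_S)` is gained up the tower.**  Layers
`F ⊆ E ⊆ E₁ ⊆ E₂`, `G_• = Gal(E_•/F)`; `O_•` the principal `S`-idèles of `E_•` inside `J_{E_•,S}` (binders `ιS_•` with `hO_•`);
layer-change pair morphisms `inflS`, `inflO` over `restrictNormalHom` commuting with the tree's `ideleInflHom` (pointwise
squares `hS`, `hO`).  If `x ∈ H²(G, O)` and `ζ ∈ H²(G₁, J_{E₁,S})` satisfy `m • ζ = Inf (ιS_* x)` and `ζ ↦ 0` in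
`H²(G₁, C_{E₁})`, and every idèle of `E₁` lies in `E₂ˣ · J_{E₂,S}` (capitulation), then `m • z = Inf_{E₁→E₂} (Inf_{E→E₁} x)`
for some `z ∈ H²(G₂, O₂)`.  Proof: cochain chase — `ζ ↦ 0` in `H²(C_{E₁})` writes a cocycle of `ζ` as
`d r + (principal)`, `r : G₁ → J_{E₁}`; capitulating the values of `r` and of the one idèle produced by `H¹(G₁, C_{E₁}) = 0`
moves everything into `J_{E₂,S} ∩ E₂ˣ = O₂`.
[cite: NeukirchSchmidtWingberg2008, (8.3.11) (iii) and its use in (8.3.17)] [cite: Harari2020, Lemma 17.21 (a), §17.4] -/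
theorem exists_smul_eq_inf_inf_sUnits_two
    -- the `S`-unit objects at the three layers
    {O : Rep ℤ (E ≃ₐ[F] E)} (ιS : O ⟶ ideleSRep F E S)
    {O₁ : Rep ℤ (E₁ ≃ₐ[F] E₁)} (ιS₁ : O₁ ⟶ ideleSRep F E₁ S)
    {O₂ : Rep ℤ (E₂ ≃ₐ[F] E₂)} (ιS₂ : O₂ ⟶ ideleSRep F E₂ S)
    (hι₂ : Function.Injective ιS₂.hom)
    (hO₂ : ∀ x : ideleSRep F E₂ S, (∃ o, ιS₂.hom o = x) ↔
      ((Additive.toMul x : ideleS F E₂ S) : ideleGroup E₂) ∈ principalIdeles E₂)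
    -- the layer-change pair morphisms and their squares
    (inflS₁ : Rep.res (AlgEquiv.restrictNormalHom E) (ideleSRep F E S) ⟶ ideleSRep F E₁ S)
    (inflS₂ : Rep.res (AlgEquiv.restrictNormalHom E₁) (ideleSRep F E₁ S) ⟶ ideleSRep F E₂ S)
    (inflO₁ : Rep.res (AlgEquiv.restrictNormalHom E) O ⟶ O₁)
    (inflO₂ : Rep.res (AlgEquiv.restrictNormalHom E₁) O₁ ⟶ O₂)
    (hS₁ : ∀ x, (ideleSRepHom S).hom (inflS₁.hom x) = (ideleInflHom F E E₁).hom ((ideleSRepHom S).hom x))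
    (hS₂ : ∀ x, (ideleSRepHom S).hom (inflS₂.hom x) = (ideleInflHom F E₁ E₂).hom ((ideleSRepHom S).hom x))
    (hO₁inf : ∀ o, ιS₁.hom (inflO₁.hom o) = inflS₁.hom (ιS.hom o))
    (hO₂inf : ∀ o, ιS₂.hom (inflO₂.hom o) = inflS₂.hom (ιS₁.hom o))
    -- capitulation of the idèles of `E₁` in `E₂`
    (hcap : ∀ a : ideleGroup E₁,
      Literature.NumberTheory.Automorphic.AdeleRing.ideleBaseChange E₁ E₂ a ∈ principalIdeles E₂ ⊔ ideleS F E₂ S)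
    (hO : ∀ x : ideleSRep F E S, (∃ o, ιS.hom o = x) ↔
      ((Additive.toMul x : ideleS F E S) : ideleGroup E) ∈ principalIdeles E)
    -- the data
    (x : groupCohomology O 2) (m : ℤ) (ζ : groupCohomology (ideleSRep F E₁ S) 2)
    (hζ : m • ζ = map (AlgEquiv.restrictNormalHom E) inflS₁ 2 (map (MonoidHom.id _) ιS 2 x))
    (hζ0 : map (MonoidHom.id _) (ideleSRepHom S ≫ IdeleClassGroup.classRepHom F E₁) 2 ζ = 0) :
    ∃ z : groupCohomology O₂ 2,
      m • z = map (AlgEquiv.restrictNormalHom E₁) inflO₂ 2 (map (AlgEquiv.restrictNormalHom E) inflO₁ 2 x) := by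
  classical
  -- Step 0: cocycle representatives of `x` and `ζ`.
  obtain ⟨cx, rfl⟩ := π_surjective _ _ x
  obtain ⟨zc, rfl⟩ := π_surjective _ _ ζ
  have hz₀ : inhomogeneousCochains.d (ideleSRep F E₁ S) 2 (iCocycles _ 2 zc) = 0 := d_iCocycles _ 2 zc
  -- Step 1: `m • z₀ - Inf_S (ιS ∘ c) = d a` with `a : G₁ → J_{E₁,S}`.
  have h1 : π (ideleSRep F E₁ S) 2 (m • zc) =
      π (ideleSRep F E₁ S) 2 (cocyclesMap (AlgEquiv.restrictNormalHom E) inflS₁ 2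
        (cocyclesMap (MonoidHom.id _) ιS 2 cx)) := by
    rw [π_zsmul, hζ, π_map_apply, π_map_apply]
  obtain ⟨a, ha⟩ := (groupCohomology_π_eq_iff _ 1 _ _).1 h1
  rw [iCocycles_zsmul, iCocycles_cocyclesMap_res, iCocycles_cocyclesMap_res] at ha
  -- Step 2: `ζ ↦ 0` in `H²(G₁, C_{E₁})`: `q ∘ πS ∘ z₀ = d ρ`, and lift `ρ = q ∘ r`, `r : G₁ → J_{E₁}`.
  have h2 : π (IdeleClassGroup.galoisRep F E₁) 2
      (cocyclesMap (MonoidHom.id _) (ideleSRepHom S ≫ IdeleClassGroup.classRepHom F E₁) 2 zc) = 0 := by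
    rw [← π_map_apply, hζ0]
  obtain ⟨ρ, hρ⟩ := (groupCohomology_π_eq_zero_iff _ 1 _).1 h2
  rw [iCocycles_cocyclesMap_res] at hρ
  have hr' := fun g => exists_classRepHom_eq (F := F) (ρ g)
  choose r hr using hr'
  have hρr : ρ = (cochainsMap (MonoidHom.id _) (IdeleClassGroup.classRepHom F E₁)).f 1 r :=
    funext fun g => by rw [cochainsMap_id_f_apply]; exact (hr g).symm
  -- `πS ∘ z₀ - d r` is pointwise principal: `= pr ∘ b`.
  have hb' : ∀ g, ∃ e : Rep.ofAlgebraAutOnUnits F E₁, (IdeleClassGroup.principalRepHom F E₁).hom e =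
      (ideleSRepHom S).hom (iCocycles _ 2 zc g) -
        inhomogeneousCochains.d (IdeleClassGroup.ideleRep F E₁) 1 r g := by
    intro g
    refine exists_principalRepHom_eq_of_classRepHom_eq_zero _ ?_
    have := congrFun hρ g
    rw [hρr, d_cochainsMap_f] at this
    rw [map_sub, sub_eq_zero]
    exact this.symm
  choose b hb using hb'
  -- Step 3: `u := πS ∘ a`; `q ∘ u - m • ρ` is a `1`-cocycle of `C_{E₁}`, hence `= d γ` (`H¹(G₁, C_{E₁}) = 0`);
  -- lift `γ = q 𝔦` and conclude `u - m • r - d 𝔦 = pr ∘ aU` pointwise.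
  have hιpr : ∀ o : O, (IdeleClassGroup.classRepHom F E).hom ((ideleSRepHom S).hom (ιS.hom o)) = 0 :=
    fun o => (classRepHom_hom_eq_zero_iff _).2 ((hO _).1 ⟨o, rfl⟩)
  -- the inflation of `ιS ∘ c` has principal values, so dies in `C_{E₁}`
  have hqInf : (cochainsMap (MonoidHom.id _) (ideleSRepHom S ≫ IdeleClassGroup.classRepHom F E₁)).f 2
      ((cochainsMap (AlgEquiv.restrictNormalHom E) inflS₁).f 2
        ((cochainsMap (MonoidHom.id _) ιS).f 2 (iCocycles O 2 cx))) = 0 := by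
    funext g
    rw [cochainsMap_id_f_apply, cochainsMap_res_f_apply, cochainsMap_id_f_apply, Rep.comp_apply, hS₁,
      ← classInflHom_classRepHom, hιpr, map_zero]
    rfl
  have h3 : inhomogeneousCochains.d (IdeleClassGroup.galoisRep F E₁) 1
      ((cochainsMap (MonoidHom.id _) (ideleSRepHom S ≫ IdeleClassGroup.classRepHom F E₁)).f 1 a - m • ρ) = 0 := by
    rw [d_apply_sub, d_apply_zsmul, d_cochainsMap_f, ha, cochainsMap_f_sub, cochainsMap_f_zsmul, hqInf, sub_zero,
      ← hρ, sub_self]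
  obtain ⟨γ, hγ⟩ := exists_d_eq_of_isZero (IdeleClassGroup.isZero_H1_galoisRep (F := F) (E := E₁)) _ h3
  obtain ⟨𝔦, h𝔦⟩ := exists_classRepHom_eq (F := F) (γ Fin.elim0)
  have hγ𝔦 : γ = (cochainsMap (MonoidHom.id _) (IdeleClassGroup.classRepHom F E₁)).f 0 (fun _ => 𝔦) :=
    funext fun g => by rw [cochainsMap_id_f_apply, h𝔦, Subsingleton.elim g Fin.elim0]
  have haU' : ∀ g, ∃ e : Rep.ofAlgebraAutOnUnits F E₁, (IdeleClassGroup.principalRepHom F E₁).hom e =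
      (ideleSRepHom S).hom (a g) - m • r g -
        inhomogeneousCochains.d (IdeleClassGroup.ideleRep F E₁) 0 (fun _ => 𝔦) g := by
    intro g
    refine exists_principalRepHom_eq_of_classRepHom_eq_zero _ ?_
    have := congrFun hγ g
    rw [hγ𝔦, d_cochainsMap_f, cochainsMap_id_f_apply, Pi.sub_apply, Pi.smul_apply, cochainsMap_id_f_apply,
      Rep.comp_apply] at this
    rw [map_sub, map_sub, map_zsmul, hr, this]
    abel
  choose aU haU using haU'
  -- Step 4: capitulate the values of `r` and the idèle `𝔦` in `E₂`.
  have hcr : ∀ g, ∃ (k : Rep.ofAlgebraAutOnUnits F E₂) (w : ideleSRep F E₂ S),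
      (IdeleClassGroup.principalRepHom F E₂).hom k + (ideleSRepHom S).hom w = (ideleInflHom F E₁ E₂).hom (r g) :=
    fun g => by
      rw [ideleInflHom_hom_apply]
      exact exists_principal_add_ideleS_eq_of_mem_sup _ (hcap (Additive.toMul (r g)))
  choose γr 𝔧r hγ𝔧r using hcr
  obtain ⟨γ₀, 𝔧₀, hγ𝔧₀⟩ : ∃ (k : Rep.ofAlgebraAutOnUnits F E₂) (w : ideleSRep F E₂ S),
      (IdeleClassGroup.principalRepHom F E₂).hom k + (ideleSRepHom S).hom w = (ideleInflHom F E₁ E₂).hom 𝔦 := by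
    rw [ideleInflHom_hom_apply]
    exact exists_principal_add_ideleS_eq_of_mem_sup _ (hcap (Additive.toMul 𝔦))
  -- the capitulation data as cochains on `G₂`
  obtain ⟨γr₂, hγr₂⟩ : ∃ t : (inhomogeneousCochains (Rep.ofAlgebraAutOnUnits F E₂)).X 1,
      ∀ g, t g = γr (AlgEquiv.restrictNormalHom E₁ ∘ g) := ⟨_, fun _ => rfl⟩
  obtain ⟨𝔧r₂, h𝔧r₂⟩ : ∃ t : (inhomogeneousCochains (ideleSRep F E₂ S)).X 1,
      ∀ g, t g = 𝔧r (AlgEquiv.restrictNormalHom E₁ ∘ g) := ⟨_, fun _ => rfl⟩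
  obtain ⟨γ₀₂, hγ₀₂⟩ : ∃ t : (inhomogeneousCochains (Rep.ofAlgebraAutOnUnits F E₂)).X 0, ∀ g, t g = γ₀ :=
    ⟨fun _ => γ₀, fun _ => rfl⟩
  obtain ⟨𝔧₀₂, h𝔧₀₂⟩ : ∃ t : (inhomogeneousCochains (ideleSRep F E₂ S)).X 0, ∀ g, t g = 𝔧₀ :=
    ⟨fun _ => 𝔧₀, fun _ => rfl⟩
  obtain ⟨𝔦₁, h𝔦₁⟩ : ∃ t : (inhomogeneousCochains (IdeleClassGroup.ideleRep F E₁)).X 0, ∀ g, t g = 𝔦 :=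
    ⟨fun _ => 𝔦, fun _ => rfl⟩
  have h𝔦₁' : (fun _ : Fin 0 → (E₁ ≃ₐ[F] E₁) => 𝔦) = 𝔦₁ := funext fun g => (h𝔦₁ g).symm
  rw [h𝔦₁'] at haU
  -- the inflated cochains `r`, `𝔦` decompose into a principal part and an `S`-idèle part
  have hInfr : (cochainsMap (AlgEquiv.restrictNormalHom E₁) (ideleInflHom F E₁ E₂)).f 1 r =
      (cochainsMap (MonoidHom.id _) (IdeleClassGroup.principalRepHom F E₂)).f 1 γr₂ +
        (cochainsMap (MonoidHom.id _) (ideleSRepHom S)).f 1 𝔧r₂ := by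
    funext g
    rw [cochainsMap_res_f_apply, Pi.add_apply, cochainsMap_id_f_apply, cochainsMap_id_f_apply, hγr₂, h𝔧r₂, hγ𝔧r]
  have hInf𝔦 : (cochainsMap (AlgEquiv.restrictNormalHom E₁) (ideleInflHom F E₁ E₂)).f 0 𝔦₁ =
      (cochainsMap (MonoidHom.id _) (IdeleClassGroup.principalRepHom F E₂)).f 0 γ₀₂ +
        (cochainsMap (MonoidHom.id _) (ideleSRepHom S)).f 0 𝔧₀₂ := by
    funext g
    rw [cochainsMap_res_f_apply, Pi.add_apply, cochainsMap_id_f_apply, cochainsMap_id_f_apply, hγ₀₂, h𝔧₀₂, h𝔦₁,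
      hγ𝔧₀]
  -- Step 5: the `2`-cochain `Inf_S z₀ - d 𝔧r₂` and the `1`-cochain `Inf_S a - m • 𝔧r₂ - d 𝔧₀₂` of `J_{E₂,S}` have
  -- principal images in `J_{E₂}`, hence come from `O₂`.
  have hw' : ∀ g, ∃ o : O₂, ιS₂.hom o =
      ((cochainsMap (AlgEquiv.restrictNormalHom E₁) inflS₂).f 2 (iCocycles _ 2 zc) -
        inhomogeneousCochains.d (ideleSRep F E₂ S) 1 𝔧r₂) g := by
    intro g
    refine (hO₂ _).2 (toMul_mem_principalIdeles_of_ideleSRepHom_eq _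
      (inhomogeneousCochains.d (Rep.ofAlgebraAutOnUnits F E₂) 1 γr₂ g +
        (unitsInflHom F E₁ E₂).hom (b (AlgEquiv.restrictNormalHom E₁ ∘ g))) ?_)
    have hz : (ideleSRepHom S).hom (iCocycles _ 2 zc (AlgEquiv.restrictNormalHom E₁ ∘ g)) =
        inhomogeneousCochains.d (IdeleClassGroup.ideleRep F E₁) 1 r (AlgEquiv.restrictNormalHom E₁ ∘ g) +
          (IdeleClassGroup.principalRepHom F E₁).hom (b (AlgEquiv.restrictNormalHom E₁ ∘ g)) := by
      rw [hb, add_sub_cancel]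
    have hdr : (ideleInflHom F E₁ E₂).hom
        (inhomogeneousCochains.d (IdeleClassGroup.ideleRep F E₁) 1 r (AlgEquiv.restrictNormalHom E₁ ∘ g)) =
        (IdeleClassGroup.principalRepHom F E₂).hom (inhomogeneousCochains.d (Rep.ofAlgebraAutOnUnits F E₂) 1 γr₂ g) +
          (ideleSRepHom S).hom (inhomogeneousCochains.d (ideleSRep F E₂ S) 1 𝔧r₂ g) := by
      rw [← cochainsMap_res_f_apply (AlgEquiv.restrictNormalHom E₁) (ideleInflHom F E₁ E₂), ← d_cochainsMap_f, hInfr,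
        d_apply_add, Pi.add_apply, d_cochainsMap_f, d_cochainsMap_f, cochainsMap_id_f_apply, cochainsMap_id_f_apply]
    rw [Pi.sub_apply, map_sub, cochainsMap_res_f_apply, hS₂, hz, map_add, hdr, ideleInflHom_principalRepHom, map_add]
    abel
  choose w hw using hw'
  have hε' : ∀ g, ∃ o : O₂, ιS₂.hom o =
      ((cochainsMap (AlgEquiv.restrictNormalHom E₁) inflS₂).f 1 a - m • 𝔧r₂ -
        inhomogeneousCochains.d (ideleSRep F E₂ S) 0 𝔧₀₂) g := by
    intro g
    refine (hO₂ _).2 (toMul_mem_principalIdeles_of_ideleSRepHom_eq _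
      (m • γr₂ g + inhomogeneousCochains.d (Rep.ofAlgebraAutOnUnits F E₂) 0 γ₀₂ g +
        (unitsInflHom F E₁ E₂).hom (aU (AlgEquiv.restrictNormalHom E₁ ∘ g))) ?_)
    have haa : (ideleSRepHom S).hom (a (AlgEquiv.restrictNormalHom E₁ ∘ g)) =
        m • r (AlgEquiv.restrictNormalHom E₁ ∘ g) +
          inhomogeneousCochains.d (IdeleClassGroup.ideleRep F E₁) 0 𝔦₁ (AlgEquiv.restrictNormalHom E₁ ∘ g) +
          (IdeleClassGroup.principalRepHom F E₁).hom (aU (AlgEquiv.restrictNormalHom E₁ ∘ g)) := by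
      rw [haU]; abel
    have hd𝔦 : (ideleInflHom F E₁ E₂).hom
        (inhomogeneousCochains.d (IdeleClassGroup.ideleRep F E₁) 0 𝔦₁ (AlgEquiv.restrictNormalHom E₁ ∘ g)) =
        (IdeleClassGroup.principalRepHom F E₂).hom
            (inhomogeneousCochains.d (Rep.ofAlgebraAutOnUnits F E₂) 0 γ₀₂ g) +
          (ideleSRepHom S).hom (inhomogeneousCochains.d (ideleSRep F E₂ S) 0 𝔧₀₂ g) := by
      rw [← cochainsMap_res_f_apply (AlgEquiv.restrictNormalHom E₁) (ideleInflHom F E₁ E₂), ← d_cochainsMap_f, hInf𝔦,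
        d_apply_add, Pi.add_apply, d_cochainsMap_f, d_cochainsMap_f, cochainsMap_id_f_apply, cochainsMap_id_f_apply]
    have hrr : (ideleInflHom F E₁ E₂).hom (r (AlgEquiv.restrictNormalHom E₁ ∘ g)) =
        (IdeleClassGroup.principalRepHom F E₂).hom (γr₂ g) + (ideleSRepHom S).hom (𝔧r₂ g) := by
      rw [hγr₂, h𝔧r₂, hγ𝔧r]
    rw [Pi.sub_apply, Pi.sub_apply, map_sub, map_sub, cochainsMap_res_f_apply, hS₂, haa, map_add, map_add, map_zsmul,
      hrr, hd𝔦, ideleInflHom_principalRepHom, Pi.smul_apply, map_zsmul, map_add, map_add, map_zsmul, smul_add]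
    abel
  choose ε hε using hε'
  -- Step 6: `w` is a cocycle and `d ε = m • w - Inf Inf c`, by injectivity of `ιS₂` on cochains.
  have hιw : (fun h => ιS₂.hom (w h)) = (cochainsMap (AlgEquiv.restrictNormalHom E₁) inflS₂).f 2 (iCocycles _ 2 zc) -
      inhomogeneousCochains.d (ideleSRep F E₂ S) 1 𝔧r₂ := funext hw
  have hιε : (fun h => ιS₂.hom (ε h)) = (cochainsMap (AlgEquiv.restrictNormalHom E₁) inflS₂).f 1 a - m • 𝔧r₂ -
      inhomogeneousCochains.d (ideleSRep F E₂ S) 0 𝔧₀₂ := funext hε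
  have hdw : inhomogeneousCochains.d O₂ 2 w = 0 := by
    funext g
    apply hι₂
    rw [← d_comp_hom_apply ιS₂ w g, hιw, d_apply_sub, d_cochainsMap_f, hz₀, cochainsMap_f_zero, d_apply_d_apply,
      sub_zero, Pi.zero_apply, Pi.zero_apply, map_zero]
  have hInfc : (cochainsMap (MonoidHom.id _) ιS₂).f 2
      ((cochainsMap (AlgEquiv.restrictNormalHom E₁) inflO₂).f 2
        ((cochainsMap (AlgEquiv.restrictNormalHom E) inflO₁).f 2 (iCocycles O 2 cx))) =
      (cochainsMap (AlgEquiv.restrictNormalHom E₁) inflS₂).f 2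
        ((cochainsMap (AlgEquiv.restrictNormalHom E) inflS₁).f 2
          ((cochainsMap (MonoidHom.id _) ιS).f 2 (iCocycles O 2 cx))) := by
    funext g
    change ιS₂.hom (inflO₂.hom (inflO₁.hom _)) = inflS₂.hom (inflS₁.hom (ιS.hom _))
    rw [hO₂inf, hO₁inf]
    exact rfl
  have hdε : inhomogeneousCochains.d O₂ 1 ε =
      m • w - (cochainsMap (AlgEquiv.restrictNormalHom E₁) inflO₂).f 2
        ((cochainsMap (AlgEquiv.restrictNormalHom E) inflO₁).f 2 (iCocycles O 2 cx)) := by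
    funext g
    apply hι₂
    have hc := congrFun hInfc g
    rw [cochainsMap_id_f_apply] at hc
    rw [← d_comp_hom_apply ιS₂ ε g, hιε, d_apply_sub, d_apply_sub, d_apply_zsmul, d_cochainsMap_f, ha,
      cochainsMap_f_sub, cochainsMap_f_zsmul, d_apply_d_apply, sub_zero, Pi.sub_apply, Pi.sub_apply, Pi.smul_apply,
      Pi.smul_apply, Pi.sub_apply, Pi.smul_apply, map_sub, map_zsmul, hw, Pi.sub_apply, smul_sub, hc]
    abel
  -- Step 7: conclusion.
  refine ⟨π O₂ 2 (cocyclesMk w hdw), ?_⟩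
  rw [← π_zsmul, π_map_apply, π_map_apply]
  refine (groupCohomology_π_eq_iff _ 1 _ _).2 ⟨ε, ?_⟩
  rw [iCocycles_zsmul, iCocycles_cocyclesMap_res, iCocycles_cocyclesMap_res, iCocycles_mk]
  exact hdε


end HTwo

end IdeleCohomology

end Literature.NumberTheory.GaloisRepresentations

end
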